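import Summits.SmoothPoincare4.SmoothPoincare4.Theorems.ConvexBisectionAcyclicBisectionExistsDualHandlePushRidge
import Summits.SmoothPoincare4.SmoothPoincare4.Theorems.ConvexBisectionAcyclicBisectionExistsDualHandlePushProfile
import HarnessLib

/-!
# Dual handles, XI: the model push `sh` of `X₁` off the cocore neighbourhood — the diffeomorphism
(brick (PUSH-c) of the sub-goal T3b step (ii) "push the prefix sub-handlebody `X₁` off the cocore
neighbourhood `N` of the suffix handles" of stub `stub_steinRealisation` (NF6), line
`modp-braid-orbits` r11, crux `ConvexBisection.AcyclicBisectionExists`, item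
stmt-SmoothPoincare4-10508; wave 3, lead c5, worker Z3)

In the model `ℝ⁴ = ℝ²_λ × ℝ²_μ` around the `j`-th belt circle (`P = ‖x_λ‖²`, `Q = ‖x_μ‖²`,
handle side `‖x‖ ≤ 1`, cocore disc `{P = 0}`; the prefix sub-handlebody minus the attaching circle
`X₁ ∖ γ` is `{P > 0}`, Kosinski's inversion `α` blowing `γ` up into the cocore disc) the push of
`X₁` off the cocore neighbourhood `N` is the **torus-equivariant map**

    sh x = modelPush κ δ x = ( √(P'/P) x_λ , √(g(P)) x_μ ),
    g = muScaleSq κ δ (file X-a),  P' = pushP κ P (g(P) Q/δ) (file X-b),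

i.e. `sh = Φ₂ ∘ Φ₁` with `Φ₁` the `μ`-scaling `Q ↦ g(P) Q` (straightening the ridge of `N` onto
the cone line) and `Φ₂` the `λ`-push `P ↦ pushP κ P (Q/δ)` at fixed `Q` (pushing the cone off the
swap slab of `N`).  This file proves that `sh` is a **diffeomorphism of the open set
`{x_λ ≠ 0}` onto the open set `pushInvDom κ δ`** with the explicit inverse `modelPushInv`
(`contDiffOn_modelPush`, `contDiffOn_modelPushInv`, `modelPushInv_modelPush`,
`modelPush_modelPushInv`, `mapsTo_modelPush`, `mapsTo_modelPushInv`), the identity on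
`{P ≥ 3κ²/4}` (`modelPush_of_ge`), acting on the squared norms by
`(P, Q) ↦ (P', g(P) Q)` (`sOf_modelPush`, `muN_modelPush`).  The image of the handle part and the
behaviour on the seam are in `…DualHandlePushImage.lean`; the formula of `sh ∘ α` near `γ`
(smooth ACROSS `γ`) in `…DualHandlePushTube.lean`.  Everything here is proved; no named facts.

## References
* J. Milnor, *Lectures on the h-cobordism theorem* (1965), §3 (dual handles). [MilnorHCobordism1965]
* A. A. Kosinski, *Differential Manifolds* (1993), VI §6. [Kosinski1993]
-/

noncomputable section

-- the prescribed namespace `Summit.<P>.<Sub>.…` duplicates `SmoothPoincare4` (P = Sub)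
set_option linter.dupNamespace false

open scoped Manifold ContDiff Topology

namespace Summit.SmoothPoincare4.SmoothPoincare4.Theorems.AcyclicBisectionExists.ModpBraidOrbits

open Set Function Metric
open Literature.Topology.FourManifolds Literature.Topology.FourManifolds.HandleAttachingMap

namespace PushModel

/-! ### §1 Torus-equivariant scalings of `ℝ²_λ × ℝ²_μ` -/

section Torus

/-- **The torus-equivariant scaling `(x_λ, x_μ) ↦ (a x_λ, b x_μ)`.** [folklore] -/
def torusScale (a b : ℝ) (x : EuclideanSpace ℝ (Fin 4)) : EuclideanSpace ℝ (Fin 4) :=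
  a • lamEmbed (lamPart x) + b • muEmbed (muPart x)

/-- `λ`-part of a scaling. [folklore] -/
@[simp] theorem lamPart_torusScale (a b : ℝ) (x : EuclideanSpace ℝ (Fin 4)) :
    lamPart (torusScale a b x) = a • lamPart x := by
  rw [torusScale, lamPart_add, lamPart_smul, lamPart_smul, lamPart_lamEmbed, lamPart_muEmbed, smul_zero,
    add_zero]

/-- `μ`-part of a scaling. [folklore] -/
@[simp] theorem muPart_torusScale (a b : ℝ) (x : EuclideanSpace ℝ (Fin 4)) :
    muPart (torusScale a b x) = b • muPart x := by
  rw [torusScale, muPart_add, muPart_smul, muPart_smul, muPart_lamEmbed, muPart_muEmbed, smul_zero,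
    zero_add]

/-- Scalings compose by multiplying the factors. [folklore] -/
theorem torusScale_torusScale (a b a' b' : ℝ) (x : EuclideanSpace ℝ (Fin 4)) :
    torusScale a b (torusScale a' b' x) = torusScale (a * a') (b * b') x := by
  rw [torusScale, lamPart_torusScale, muPart_torusScale, lamEmbed_smul, muEmbed_smul, smul_smul, smul_smul,
    torusScale]

/-- The trivial scaling. [folklore] -/
@[simp] theorem torusScale_one_one (x : EuclideanSpace ℝ (Fin 4)) : torusScale 1 1 x = x := by
  rw [torusScale, one_smul, one_smul, lamEmbed_add_muEmbed]

/-- `‖(√c • v)‖² = c ‖v‖²` for `c ≥ 0`. [folklore] -/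
theorem norm_sqrt_smul_sq {c : ℝ} (hc : 0 ≤ c) (v : EuclideanSpace ℝ (Fin 2)) :
    ‖Real.sqrt c • v‖ ^ 2 = c * ‖v‖ ^ 2 := by
  rw [norm_smul, mul_pow, Real.norm_of_nonneg (Real.sqrt_nonneg _), Real.sq_sqrt hc]

/-- A scaling with smooth factors is smooth. [folklore] -/
theorem contDiffOn_torusScale {f g : EuclideanSpace ℝ (Fin 4) → ℝ} {s : Set (EuclideanSpace ℝ (Fin 4))}
    (hf : ContDiffOn ℝ ∞ f s) (hg : ContDiffOn ℝ ∞ g s) :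
    ContDiffOn ℝ ∞ (fun x => torusScale (f x) (g x) x) s :=
  (hf.smul (contDiff_lamEmbed.comp contDiff_lamPart).contDiffOn).add
    (hg.smul (contDiff_muEmbed.comp contDiff_muPart).contDiffOn)

end Torus

/-! ### §2 The push and its inverse -/

section Push

variable {κ δ : ℝ}

/-- `Q = ‖x_μ‖²`. [folklore] -/
def muN (x : EuclideanSpace ℝ (Fin 4)) : ℝ := ‖muPart x‖ ^ 2

/-- `Q` is smooth. [folklore] -/
theorem contDiff_muN : ContDiff ℝ ∞ muN := (contDiff_norm_sq ℝ).comp contDiff_muPart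

/-- **THE MODEL PUSH** `sh x = (√(P'/P) x_λ, √(g(P)) x_μ)`, `P = sOf x`, `Q = muN x`,
`g = muScaleSq κ δ`, `P' = pushP κ P (g(P) Q/δ)`. [cite: MilnorHCobordism1965, §3] -/
def modelPush (κ δ : ℝ) (x : EuclideanSpace ℝ (Fin 4)) : EuclideanSpace ℝ (Fin 4) :=
  torusScale (Real.sqrt (pushP κ (sOf x) (muScaleSq κ δ (sOf x) * muN x / δ) / sOf x))
    (Real.sqrt (muScaleSq κ δ (sOf x))) x

/-- **THE INVERSE** `sh⁻¹ x = (√(P₀/P) x_λ, x_μ/√(g(P₀)))`, `P₀ = pullP κ P (Q/δ)`. [folklore] -/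
def modelPushInv (κ δ : ℝ) (x : EuclideanSpace ℝ (Fin 4)) : EuclideanSpace ℝ (Fin 4) :=
  torusScale (Real.sqrt (pullP κ (sOf x) (muN x / δ) / sOf x))
    (Real.sqrt (muScaleSq κ δ (pullP κ (sOf x) (muN x / δ))))⁻¹ x

/-- **The target open set** `{x | (P, Q/δ) ∈ pullDom κ}`. [folklore] -/
def pushInvDom (κ δ : ℝ) : Set (EuclideanSpace ℝ (Fin 4)) := {x | (sOf x, muN x / δ) ∈ pullDom κ}

/-- `x_λ ≠ 0 ↔ 0 < P`. [folklore] -/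
theorem sOf_pos_iff {x : EuclideanSpace ℝ (Fin 4)} : 0 < sOf x ↔ lamPart x ≠ 0 := by
  rw [sOf, sq_pos_iff, norm_ne_zero_iff]

/-- The pushed level is at least `P`, hence positive off the cocore. [folklore] -/
theorem sOf_le_pushLevel (hκ : 0 < κ) (x : EuclideanSpace ℝ (Fin 4)) (q : ℝ) : sOf x ≤ pushP κ (sOf x) q :=
  le_pushP hκ _ _

/-- **`P (sh x) = P'`.** [folklore] -/
theorem sOf_modelPush (hκ : 0 < κ) {x : EuclideanSpace ℝ (Fin 4)} (hx : lamPart x ≠ 0) :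
    sOf (modelPush κ δ x) = pushP κ (sOf x) (muScaleSq κ δ (sOf x) * muN x / δ) := by
  have hP := sOf_pos_iff.2 hx
  have hP' := lt_of_lt_of_le hP (sOf_le_pushLevel hκ x (muScaleSq κ δ (sOf x) * muN x / δ))
  rw [sOf, modelPush, lamPart_torusScale, norm_sqrt_smul_sq (div_pos hP' hP).le, ← sOf, div_mul_cancel₀ _ hP.ne']

/-- **`Q (sh x) = g(P) Q`.** [folklore] -/
theorem muN_modelPush (hκ : 0 < κ) (hκ2 : κ ≤ 1 / 2) (hδ : 0 < δ) {x : EuclideanSpace ℝ (Fin 4)}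
    (hx : lamPart x ≠ 0) : muN (modelPush κ δ x) = muScaleSq κ δ (sOf x) * muN x := by
  rw [muN, modelPush, muPart_torusScale, norm_sqrt_smul_sq (muScaleSq_pos hκ hκ2 hδ (sOf_pos_iff.2 hx)).le, muN]

/-- **`sh = id` on `P ≥ 3κ²/4`.** [folklore] -/
theorem modelPush_of_ge (hκ : 0 < κ) {x : EuclideanSpace ℝ (Fin 4)} (hx : 3 * κ ^ 2 / 4 ≤ sOf x) :
    modelPush κ δ x = x := by
  have hP : 0 < sOf x := lt_of_lt_of_le (by positivity) hx
  rw [modelPush, muScaleSq_of_ge hκ hx, pushP_of_ge _ (by linarith), div_self hP.ne', Real.sqrt_one,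
    torusScale_one_one]

/-- `sh` keeps the torus directions with POSITIVE factors. [folklore] -/
theorem modelPush_eq_torusScale (hκ : 0 < κ) (hκ2 : κ ≤ 1 / 2) (hδ : 0 < δ) {x : EuclideanSpace ℝ (Fin 4)}
    (hx : lamPart x ≠ 0) : ∃ a b : ℝ, 0 < a ∧ 0 < b ∧ modelPush κ δ x = torusScale a b x := by
  have hP := sOf_pos_iff.2 hx
  have hP' := lt_of_lt_of_le hP (sOf_le_pushLevel hκ x (muScaleSq κ δ (sOf x) * muN x / δ))
  exact ⟨_, _, Real.sqrt_pos.2 (div_pos hP' hP), Real.sqrt_pos.2 (muScaleSq_pos hκ hκ2 hδ hP), rfl⟩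

/-- **`sh` is smooth off the cocore.** [folklore] -/
theorem contDiffOn_modelPush (hκ : 0 < κ) (hκ2 : κ ≤ 1 / 2) (hδ : 0 < δ) :
    ContDiffOn ℝ ∞ (modelPush κ δ) {x | lamPart x ≠ 0} := by
  have hg : ContDiff ℝ ∞ fun x => muScaleSq κ δ (sOf x) := (contDiff_muScaleSq hκ hκ2 δ).comp contDiff_sOf
  have hq : ContDiff ℝ ∞ fun x => muScaleSq κ δ (sOf x) * muN x / δ := (hg.mul contDiff_muN).div_const δ
  have hP' : ContDiff ℝ ∞ fun x => pushP κ (sOf x) (muScaleSq κ δ (sOf x) * muN x / δ) :=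
    (contDiff_pushP hκ).comp (contDiff_sOf.prodMk hq)
  refine contDiffOn_torusScale (ContDiffOn.sqrt ?_ fun x hx => ?_) (hg.contDiffOn.sqrt fun x hx => ?_)
  · exact hP'.contDiffOn.div contDiff_sOf.contDiffOn fun x hx => (sOf_pos_iff.2 hx).ne'
  · have hP := sOf_pos_iff.2 hx
    exact (div_pos (lt_of_lt_of_le hP (sOf_le_pushLevel hκ x _)) hP).ne'
  · exact (muScaleSq_pos hκ hκ2 hδ (sOf_pos_iff.2 hx)).ne'

/-- **`sh⁻¹ ∘ sh = id` off the cocore.** [folklore] -/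
theorem modelPushInv_modelPush (hκ : 0 < κ) (hκ2 : κ ≤ 1 / 2) (hδ : 0 < δ) {x : EuclideanSpace ℝ (Fin 4)}
    (hx : lamPart x ≠ 0) : modelPushInv κ δ (modelPush κ δ x) = x := by
  have hP := sOf_pos_iff.2 hx
  set g := muScaleSq κ δ (sOf x) with hg
  have hg0 : 0 < g := muScaleSq_pos hκ hκ2 hδ hP
  set P' := pushP κ (sOf x) (g * muN x / δ) with hP'd
  have hP' : 0 < P' := lt_of_lt_of_le hP (sOf_le_pushLevel hκ x _)
  have h1 : sOf (modelPush κ δ x) = P' := sOf_modelPush hκ hx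
  have h2 : muN (modelPush κ δ x) = g * muN x := muN_modelPush hκ hκ2 hδ hx
  have h3 : pullP κ P' (g * muN x / δ) = sOf x := pullP_pushP hκ _ _
  rw [modelPushInv, h1, h2, h3]
  conv_lhs => rw [modelPush, ← hg, ← hP'd, torusScale_torusScale]
  rw [← Real.sqrt_mul (div_pos hP hP').le, div_mul_div_comm, mul_comm, div_self (mul_pos hP' hP).ne',
    Real.sqrt_one, inv_mul_cancel₀ (Real.sqrt_pos.2 hg0).ne', torusScale_one_one]

/-- **`sh` maps `{x_λ ≠ 0}` into `pushInvDom`.** [folklore] -/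
theorem mapsTo_modelPush (hκ : 0 < κ) (hκ2 : κ ≤ 1 / 2) (hδ : 0 < δ) :
    MapsTo (modelPush κ δ) {x | lamPart x ≠ 0} (pushInvDom κ δ) := by
  intro x hx
  have hP := sOf_pos_iff.2 hx
  rw [mem_setOf_eq] at hx
  rw [pushInvDom, mem_setOf_eq, sOf_modelPush hκ hx, muN_modelPush hκ hκ2 hδ hx]
  rcases lt_or_ge (sOf x) (κ ^ 2 / 2) with h | h
  · have hm := pushP_mem hκ h (q := muScaleSq κ δ (sOf x) * muN x / δ)
    exact mem_pullDom_of_exp_lt hm.2 (exp_lt_exp_pushP hκ hP h)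
  · exact mem_pullDom_of_ge (by rw [pushP_of_ge _ h]; exact h)

/-- The target set is open. [folklore] -/
theorem isOpen_pushInvDom (hκ : 0 < κ) (δ : ℝ) : IsOpen (pushInvDom κ δ) :=
  (isOpen_pullDom hκ).preimage (contDiff_sOf.continuous.prodMk (contDiff_muN.div_const δ).continuous)

/-- On the target set `P > 0`. [folklore] -/
theorem sOf_pos_of_mem (hκ : 0 < κ) {x : EuclideanSpace ℝ (Fin 4)} (hx : x ∈ pushInvDom κ δ) : 0 < sOf x := by
  by_contra h
  have h0 : sOf x = 0 := le_antisymm (not_lt.1 h) (sq_nonneg _)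
  have hx' := hx
  rw [pushInvDom, mem_setOf_eq, pullDom, mem_setOf_eq, h0, sub_zero] at hx'
  have hφ : expNegInvGlue (κ ^ 2 / 2) = (Real.exp (2 / κ ^ 2))⁻¹ := by
    rw [expNegInvGlue, if_neg (not_le.2 (by positivity)), ← Real.exp_neg]
    congr 1; field_simp
  rw [hφ, inv_mul_lt_iff₀ (Real.exp_pos _), mul_one] at hx'
  linarith [pushShift_nonneg hκ (muN x / δ)]

/-- On the target set the pulled level `P₀ = pullP κ P (Q/δ)` is positive. [folklore] -/
theorem pullLevel_pos (hκ : 0 < κ) {x : EuclideanSpace ℝ (Fin 4)} (hx : x ∈ pushInvDom κ δ) :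
    0 < pullP κ (sOf x) (muN x / δ) := by
  rcases lt_or_ge (sOf x) (κ ^ 2 / 2) with h | h
  · exact pullP_pos hκ h (exp_lt_of_mem_pullDom hx h)
  · rw [pullP_of_ge _ h]; exact sOf_pos_of_mem hκ hx

/-- `pushP (pullP P) = P` on the target set. [folklore] -/
theorem pushP_pullLevel (hκ : 0 < κ) {x : EuclideanSpace ℝ (Fin 4)} (hx : x ∈ pushInvDom κ δ) :
    pushP κ (pullP κ (sOf x) (muN x / δ)) (muN x / δ) = sOf x := by
  refine pushP_pullP hκ fun h => ?_
  have h1 : (1 : ℝ) < Real.exp (2 / κ ^ 2) := Real.one_lt_exp_iff.2 (by positivity)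
  linarith [exp_lt_of_mem_pullDom hx h]

/-- **`sh⁻¹` is smooth on the target set.** [folklore] -/
theorem contDiffOn_modelPushInv (hκ : 0 < κ) (hκ2 : κ ≤ 1 / 2) (hδ : 0 < δ) :
    ContDiffOn ℝ ∞ (modelPushInv κ δ) (pushInvDom κ δ) := by
  have hpq : ContDiff ℝ ∞ fun x : EuclideanSpace ℝ (Fin 4) => (sOf x, muN x / δ) :=
    contDiff_sOf.prodMk (contDiff_muN.div_const δ)
  have hpull : ContDiffOn ℝ ∞ (fun x => pullP κ (sOf x) (muN x / δ)) (pushInvDom κ δ) :=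
    (contDiffOn_pullP hκ).comp hpq.contDiffOn fun x hx => hx
  refine contDiffOn_torusScale (ContDiffOn.sqrt ?_ fun x hx => ?_) (ContDiffOn.inv ?_ fun x hx => ?_)
  · exact hpull.div contDiff_sOf.contDiffOn fun x hx => (sOf_pos_of_mem hκ hx).ne'
  · exact (div_pos (pullLevel_pos hκ hx) (sOf_pos_of_mem hκ hx)).ne'
  · exact ((contDiff_muScaleSq hκ hκ2 δ).comp_contDiffOn hpull).sqrt fun x hx =>
      (muScaleSq_pos hκ hκ2 hδ (pullLevel_pos hκ hx)).ne'
  · exact (Real.sqrt_pos.2 (muScaleSq_pos hκ hκ2 hδ (pullLevel_pos hκ hx))).ne'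

/-- `P (sh⁻¹ x) = P₀`. [folklore] -/
theorem sOf_modelPushInv (hκ : 0 < κ) {x : EuclideanSpace ℝ (Fin 4)} (hx : x ∈ pushInvDom κ δ) :
    sOf (modelPushInv κ δ x) = pullP κ (sOf x) (muN x / δ) := by
  have hP := sOf_pos_of_mem hκ hx
  rw [sOf, modelPushInv, lamPart_torusScale, norm_sqrt_smul_sq (div_pos (pullLevel_pos hκ hx) hP).le, ← sOf,
    div_mul_cancel₀ _ hP.ne']

/-- `Q (sh⁻¹ x) = Q/g(P₀)`. [folklore] -/
theorem muN_modelPushInv (hκ : 0 < κ) (hκ2 : κ ≤ 1 / 2) (hδ : 0 < δ) {x : EuclideanSpace ℝ (Fin 4)}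
    (hx : x ∈ pushInvDom κ δ) :
    muN (modelPushInv κ δ x) = (muScaleSq κ δ (pullP κ (sOf x) (muN x / δ)))⁻¹ * muN x := by
  have hg := muScaleSq_pos hκ hκ2 hδ (pullLevel_pos hκ hx)
  rw [muN, modelPushInv, muPart_torusScale, norm_smul, mul_pow, norm_inv, inv_pow,
    Real.norm_of_nonneg (Real.sqrt_nonneg _), Real.sq_sqrt hg.le, muN]

/-- **`sh ∘ sh⁻¹ = id` on the target set.** [folklore] -/
theorem modelPush_modelPushInv (hκ : 0 < κ) (hκ2 : κ ≤ 1 / 2) (hδ : 0 < δ) {x : EuclideanSpace ℝ (Fin 4)}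
    (hx : x ∈ pushInvDom κ δ) : modelPush κ δ (modelPushInv κ δ x) = x := by
  have hP := sOf_pos_of_mem hκ hx
  set P₀ := pullP κ (sOf x) (muN x / δ) with hP₀d
  have hP₀ : 0 < P₀ := pullLevel_pos hκ hx
  set g := muScaleSq κ δ P₀ with hgd
  have hg : 0 < g := muScaleSq_pos hκ hκ2 hδ hP₀
  have h1 : sOf (modelPushInv κ δ x) = P₀ := sOf_modelPushInv hκ hx
  have h2 : muN (modelPushInv κ δ x) = g⁻¹ * muN x := muN_modelPushInv hκ hκ2 hδ hx
  have h3 : g * (g⁻¹ * muN x) / δ = muN x / δ := by rw [← mul_assoc, mul_inv_cancel₀ hg.ne', one_mul]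
  have h4 : pushP κ P₀ (muN x / δ) = sOf x := pushP_pullLevel hκ hx
  rw [modelPush, h1, h2, ← hgd, h3, h4]
  conv_lhs => rw [modelPushInv, ← hP₀d, ← hgd, torusScale_torusScale]
  rw [← Real.sqrt_mul (div_pos hP hP₀).le, div_mul_div_comm, mul_comm, div_self (mul_pos hP₀ hP).ne',
    Real.sqrt_one, mul_inv_cancel₀ (Real.sqrt_pos.2 hg).ne', torusScale_one_one]

/-- **`sh⁻¹` maps the target set into `{x_λ ≠ 0}`.** [folklore] -/
theorem mapsTo_modelPushInv (hκ : 0 < κ) :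
    MapsTo (modelPushInv κ δ) (pushInvDom κ δ) {x | lamPart x ≠ 0} := fun x hx =>
  sOf_pos_iff.1 (by rw [sOf_modelPushInv hκ hx]; exact pullLevel_pos hκ hx)

/-- The push image of `{x_λ ≠ 0}` is exactly the target set. [folklore] -/
theorem image_modelPush (hκ : 0 < κ) (hκ2 : κ ≤ 1 / 2) (hδ : 0 < δ) :
    modelPush κ δ '' {x | lamPart x ≠ 0} = pushInvDom κ δ :=
  Subset.antisymm ((mapsTo_modelPush hκ hκ2 hδ).image_subset) fun x hx =>
    ⟨modelPushInv κ δ x, mapsTo_modelPushInv hκ hx, modelPush_modelPushInv hκ hκ2 hδ hx⟩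

end Push

end PushModel

/-- **Registered helper `helper_modelPush_diffeo` (brick (PUSH-c) of T3b (ii), sub-goal of NF6
`stub_steinRealisation`, wave 3, lead c5): the model push `modelPush κ δ` of `X₁` off the cocore
neighbourhood is a diffeomorphism of the open set `{x_λ ≠ 0} ⊂ ℝ⁴` (the handle-chart image of
`X₁ ∖ γ`) onto the open set `pushInvDom κ δ`, with inverse `modelPushInv κ δ`, the identity on
`{‖x_λ‖² ≥ 3κ²/4}`, scaling `x_λ` and `x_μ` by positive factors.** [folklore] -/
theorem helper_modelPush_diffeo : ∀ {κ δ : ℝ}, 0 < κ → κ ≤ 1 / 2 → 0 < δ → IsOpen (Summit.SmoothPoincare4.SmoothPoincare4.Theorems.AcyclicBisectionExists.ModpBraidOrbits.PushModel.pushInvDom κ δ) ∧ ContDiffOn ℝ ∞ (Summit.SmoothPoincare4.SmoothPoincare4.Theorems.AcyclicBisectionExists.ModpBraidOrbits.PushModel.modelPush κ δ) {x : EuclideanSpace ℝ (Fin 4) | Literature.Topology.FourManifolds.lamPart x ≠ 0} ∧ ContDiffOn ℝ ∞ (Summit.SmoothPoincare4.SmoothPoincare4.Theorems.AcyclicBisectionExists.ModpBraidOrbits.PushModel.modelPushInv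 κ δ) (Summit.SmoothPoincare4.SmoothPoincare4.Theorems.AcyclicBisectionExists.ModpBraidOrbits.PushModel.pushInvDom κ δ) ∧ Summit.SmoothPoincare4.SmoothPoincare4.Theorems.AcyclicBisectionExists.ModpBraidOrbits.PushModel.modelPush κ δ '' {x : EuclideanSpace ℝ (Fin 4) | Literature.Topology.FourManifolds.lamPart x ≠ 0} = Summit.SmoothPoincare4.SmoothPoincare4.Theorems.AcyclicBisectionExists.ModpBraidOrbits.PushModel.pushInvDom κ δ ∧ (∀ x : EuclideanSpace ℝ (Fin 4), Literature.Topology.FourManifolds.lamPart x ≠ 0 → Summit.SmoothPoincare4.SmoothPoincare4.Theorems.AcyclicBisectionExists.ModpBraidOrbits.PushModel.modelPushInv κ δ (Summit.SmoothPoincare4.SmoothPoincare4.Theorems.AcyclicBisectionExists.ModpBraidOrbits.PushModel.modelPush κ δ x) = x) ∧ (∀ x ∈ Summit.SmoothPoincare4.SmoothPoincare4.Theorems.AcyclicBisectionExists.ModpBraidOrbits.PushModel.pushInvDom κ δ, Summit.SmoothPoincare4.SmoothPoincare4.Theorems.AcyclicBisectionExists.ModpBraidOrbits.PushModel.modelPush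 κ δ (Summit.SmoothPoincare4.SmoothPoincare4.Theorems.AcyclicBisectionExists.ModpBraidOrbits.PushModel.modelPushInv κ δ x) = x) ∧ (∀ x : EuclideanSpace ℝ (Fin 4), 3 * κ ^ 2 / 4 ≤ ‖Literature.Topology.FourManifolds.lamPart x‖ ^ 2 → Summit.SmoothPoincare4.SmoothPoincare4.Theorems.AcyclicBisectionExists.ModpBraidOrbits.PushModel.modelPush κ δ x = x) ∧ (∀ x : EuclideanSpace ℝ (Fin 4), Literature.Topology.FourManifolds.lamPart x ≠ 0 → ∃ a b : ℝ, 0 < a ∧ 0 < b ∧ Literature.Topology.FourManifolds.lamPart (Summit.SmoothPoincare4.SmoothPoincare4.Theorems.AcyclicBisectionExists.ModpBraidOrbits.PushModel.modelPush κ δ x) = a • Literature.Topology.FourManifolds.lamPart x ∧ Literature.Topology.FourManifolds.muPart (Summit.SmoothPoincare4.SmoothPoincare4.Theorems.AcyclicBisectionExists.ModpBraidOrbits.PushModel.modelPush κ δ x) = b • Literature.Topology.FourManifolds.muPart x) := by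
  intro κ δ hκ hκ2 hδ
  refine ⟨PushModel.isOpen_pushInvDom hκ δ, PushModel.contDiffOn_modelPush hκ hκ2 hδ,
    PushModel.contDiffOn_modelPushInv hκ hκ2 hδ, PushModel.image_modelPush hκ hκ2 hδ,
    fun x hx => PushModel.modelPushInv_modelPush hκ hκ2 hδ hx,
    fun x hx => PushModel.modelPush_modelPushInv hκ hκ2 hδ hx,
    fun x hx => PushModel.modelPush_of_ge hκ (by rwa [sOf]), fun x hx => ?_⟩
  obtain ⟨a, b, ha, hb, h⟩ := PushModel.modelPush_eq_torusScale hκ hκ2 hδ hx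
  exact ⟨a, b, ha, hb, by rw [h, PushModel.lamPart_torusScale], by rw [h, PushModel.muPart_torusScale]⟩

end Summit.SmoothPoincare4.SmoothPoincare4.Theorems.AcyclicBisectionExists.ModpBraidOrbits

end
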